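import Mathlib
import Literature.Computability.Complexity.CliqueTestGraphs
import Summits.PneNP.PneNP.Theorems.ConvexRankGatesConvexGateBlindConverse
import Summits.PneNP.PneNP.Theorems.ConvexRankGatesConvexGateBlindCliqueDistance

/-!
# PneNP / ConvexRankGates — `ConvexGateBlind`: a factorisation of `D - εJ` gives back an LP gate

Helpers (`--supports stmt-PneNP-10680`): the converse of `…CliqueDistance.lean`, completing the LP slice of
the crux as a statement about ONE explicit matrix family. If `D[Q,u] - ε = ∑_l U_{u,l} V_{l,Q}` with
`U, V ≥ 0` (`r` terms, `ε > 0`; `D[Q,u] = #(E(Q) ∖ u)`, `Q` the `k`-sets, `u` the `k`-clique-free graphs),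
then an LP-feasibility gate with `#E + r` variables `(x', s) ≥ 0` and at most `2(#E + r + 1) + #E` rows
computes `CLIQUE(m, k)` (`exists_lpData_of_cliqueDist_factorisation`): rows `x'_e ≤ [x_e]` and a linearly
independent subfamily of the equations `∑_{e ∉ u} x'_e - ∑_l U_{u,l} s_l = ε` (the certificate system
`w_u = 1_{E∖u}`, `θ_u = ε` of Hrubeš's polyhedron `S_ε`). With `lpDataHard_of_cliqueDist_rankHard` this
gives the equivalence `cliqueDist_rankHard_iff_lpDataHard`: the LP data form of the crux (for a given `δ`)
holds iff for every `c`, eventually, `D - εJ` has no non-negative factorisation with `≤ m^c` terms for any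
`ε > 0` — Hrubeš's Open Problem 3/4 for this matrix. [folklore; cf. Hrubeš 2020 (`Hrubes2020`), Thm. 20]
-/

namespace Summit.PneNP.PneNP.Theorems

open Matrix Finset Literature.Computability.Complexity

/-- Re-indexing an LP-feasibility system by `Fin`. [folklore] -/
theorem lp_feasible_reindex {ι R C : Type*} [Fintype ι] [Fintype R] [Fintype C]
    (A : R → C → ℝ) (b : R → ℝ) (B : R → ι → ℝ) :
    ∃ (A' : Fin (Fintype.card R) → Fin (Fintype.card C) → ℝ) (b' : Fin (Fintype.card R) → ℝ)
      (B' : Fin (Fintype.card R) → ι → ℝ), (∀ i e, B' i e = B ((Fintype.equivFin R).symm i) e) ∧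
      ∀ rhs : R → ℝ, (∀ i, b' i = b ((Fintype.equivFin R).symm i)) ∧
        ((∃ z : C → ℝ, (∀ c, 0 ≤ z c) ∧ ∀ ρ, ∑ c, A ρ c * z c ≤ rhs ρ) ↔
         (∃ z' : Fin (Fintype.card C) → ℝ, (∀ j, 0 ≤ z' j) ∧
           ∀ i, ∑ j, A' i j * z' j ≤ rhs ((Fintype.equivFin R).symm i))) := by
  classical
  set eR := Fintype.equivFin R
  set eC := Fintype.equivFin C
  refine ⟨fun i j => A (eR.symm i) (eC.symm j), fun i => b (eR.symm i), fun i e => B (eR.symm i) e,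
    fun _ _ => rfl, fun rhs => ⟨fun _ => rfl, ?_⟩⟩
  constructor
  · rintro ⟨z, hz, hrows⟩
    refine ⟨fun j => z (eC.symm j), fun j => hz _, fun i => ?_⟩
    have h := hrows (eR.symm i)
    rwa [← Equiv.sum_comp eC.symm (fun c => A (eR.symm i) c * z c)] at h
  · rintro ⟨z', hz', hrows⟩
    refine ⟨fun c => z' (eC c), fun c => hz' _, fun ρ => ?_⟩
    have h := hrows (eR ρ)
    simp only [Equiv.symm_apply_apply] at h
    rw [← Equiv.sum_comp eC.symm (fun c => A ρ c * z' (eC c))]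
    simpa using h

/-- **A non-negative factorisation of `D - εJ` yields one LP gate computing CLIQUE** (`ε > 0`), with
`#E + r` variables and rows indexed by a finite type of size `≤ 2 (#E + r + 1) + #E`; only the rows
`x'_e ≤ [x_e]` read the input (coefficient `+1`). [folklore; cf. Hrubeš 2020 (`Hrubes2020`), Thm. 20,
direction "small rank ⇒ separator"] -/
theorem exists_lpData_of_cliqueDist_factorisation {m k r : ℕ} {ε : ℝ} (hε : 0 < ε)
    (U : ((⊤ : SimpleGraph (Fin m)).edgeSet → Bool) → Fin r → ℝ) (V : Fin r → Finset (Fin m) → ℝ)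
    (hU : ∀ u l, 0 ≤ U u l) (hV : ∀ l Q, 0 ≤ V l Q)
    (hfact : ∀ (Q : Finset (Fin m)) (u : (⊤ : SimpleGraph (Fin m)).edgeSet → Bool), Q.card = k → cliqueFn m k u = false →
      (∑ e, if cliqueVec Q e = true ∧ u e = false then (1 : ℝ) else 0) - ε = ∑ l, U u l * V l Q) :
    ∃ (R : Type) (_ : Fintype R), Fintype.card R ≤ 2 * (Fintype.card (⊤ : SimpleGraph (Fin m)).edgeSet + r + 1) + Fintype.card (⊤ : SimpleGraph (Fin m)).edgeSet ∧
      ∃ (A : R → ((⊤ : SimpleGraph (Fin m)).edgeSet ⊕ Fin r) → ℝ) (b : R → ℝ) (B : R → (⊤ : SimpleGraph (Fin m)).edgeSet → ℝ), (∀ i e, 0 ≤ B i e) ∧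
        ∀ x : (⊤ : SimpleGraph (Fin m)).edgeSet → Bool, cliqueFn m k x = true ↔
          ∃ z : ((⊤ : SimpleGraph (Fin m)).edgeSet ⊕ Fin r) → ℝ, (∀ c, 0 ≤ z c) ∧ ∀ i, ∑ c, A i c * z c ≤ b i + ∑ e, B i e * (if x e then (1 : ℝ) else 0) := by
  classical
  -- equation functionals `(x'-part, s-part, constant)` and their evaluation
  let φ : ((⊤ : SimpleGraph (Fin m)).edgeSet → Bool) → (((⊤ : SimpleGraph (Fin m)).edgeSet → ℝ) × ((Fin r → ℝ) × ℝ)) := fun u => (fun e => if u e then 0 else 1, (-(U u), -ε))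
  let ev : ((⊤ : SimpleGraph (Fin m)).edgeSet → ℝ) → (Fin r → ℝ) → (((⊤ : SimpleGraph (Fin m)).edgeSet → ℝ) × ((Fin r → ℝ) × ℝ)) →ₗ[ℝ] ℝ := fun x' sv =>
    { toFun := fun c => c.1 ⬝ᵥ x' + c.2.1 ⬝ᵥ sv + c.2.2
      map_add' := fun c c' => by
        rw [Prod.fst_add, Prod.snd_add, Prod.fst_add, Prod.snd_add, add_dotProduct, add_dotProduct]
        ring
      map_smul' := fun a c => by
        rw [Prod.smul_fst, Prod.smul_snd, Prod.smul_fst, Prod.smul_snd, smul_dotProduct, smul_dotProduct,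
          smul_eq_mul, smul_eq_mul, smul_eq_mul, RingHom.id_apply]
        ring }
  have hev : ∀ x' sv u, ev x' sv (φ u) =
      ∑ e, (if u e then 0 else 1) * x' e - ∑ l, U u l * sv l - ε := by
    intro x' sv u
    simp only [ev, φ, LinearMap.coe_mk, AddHom.coe_mk, dotProduct, Pi.neg_apply, neg_mul,
      Finset.sum_neg_distrib]
    ring
  -- a linearly independent spanning subfamily of the equations
  let T : Set (((⊤ : SimpleGraph (Fin m)).edgeSet → ℝ) × ((Fin r → ℝ) × ℝ)) := Set.range fun u : {u : (⊤ : SimpleGraph (Fin m)).edgeSet → Bool // cliqueFn m k u = false} => φ u.1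
  obtain ⟨bset, hbT, hspan, hli⟩ := exists_linearIndependent ℝ T
  have hbfin : bset.Finite := (Set.finite_range _).subset hbT
  obtain ⟨bf, rfl⟩ := hbfin.exists_finset_coe
  have hbcard : bf.card ≤ Fintype.card (⊤ : SimpleGraph (Fin m)).edgeSet + r + 1 := by
    have h := LinearIndependent.finset_card_le_finrank (b := bf) hli
    have hdim : Module.finrank ℝ (((⊤ : SimpleGraph (Fin m)).edgeSet → ℝ) × ((Fin r → ℝ) × ℝ)) = Fintype.card (⊤ : SimpleGraph (Fin m)).edgeSet + r + 1 := by
      rw [Module.finrank_prod, Module.finrank_prod, Module.finrank_fintype_fun_eq_card,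
        Module.finrank_fintype_fun_eq_card, Module.finrank_self, Fintype.card_fin]
      ring
    omega
  have hTspan : T ⊆ (Submodule.span ℝ ((bf : Finset (((⊤ : SimpleGraph (Fin m)).edgeSet → ℝ) × ((Fin r → ℝ) × ℝ))) : Set (((⊤ : SimpleGraph (Fin m)).edgeSet → ℝ) × ((Fin r → ℝ) × ℝ))) : Set (((⊤ : SimpleGraph (Fin m)).edgeSet → ℝ) × ((Fin r → ℝ) × ℝ))) := by
    rw [hspan]; exact Submodule.subset_span
  refine ⟨(bf ⊕ bf) ⊕ (⊤ : SimpleGraph (Fin m)).edgeSet, inferInstance, ?_, ?_⟩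
  · simp only [Fintype.card_sum, Fintype.card_coe]
    omega
  -- rows
  let Arow : (((⊤ : SimpleGraph (Fin m)).edgeSet → ℝ) × ((Fin r → ℝ) × ℝ)) → ((⊤ : SimpleGraph (Fin m)).edgeSet ⊕ Fin r) → ℝ := fun c => Sum.elim c.1 c.2.1
  let A : (bf ⊕ bf) ⊕ (⊤ : SimpleGraph (Fin m)).edgeSet → ((⊤ : SimpleGraph (Fin m)).edgeSet ⊕ Fin r) → ℝ :=
    Sum.elim (Sum.elim (fun β => Arow β.1) (fun β => -Arow β.1)) (fun e => Sum.elim (fun e' => if e' = e then 1 else 0) 0)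
  let bvec : (bf ⊕ bf) ⊕ (⊤ : SimpleGraph (Fin m)).edgeSet → ℝ :=
    Sum.elim (Sum.elim (fun β => -β.1.2.2) (fun β => β.1.2.2)) (fun _ => 0)
  let B : (bf ⊕ bf) ⊕ (⊤ : SimpleGraph (Fin m)).edgeSet → (⊤ : SimpleGraph (Fin m)).edgeSet → ℝ := Sum.elim (fun _ _ => 0) (fun e e' => if e' = e then 1 else 0)
  refine ⟨A, bvec, B, ?_, fun x => ?_⟩
  · rintro (β | e) e'
    · simp [B]
    · simp only [B, Sum.elim_inr]
      split_ifs <;> norm_num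
  have hArow : ∀ (c : (((⊤ : SimpleGraph (Fin m)).edgeSet → ℝ) × ((Fin r → ℝ) × ℝ))) (zv : ((⊤ : SimpleGraph (Fin m)).edgeSet ⊕ Fin r) → ℝ),
      ∑ c', Arow c c' * zv c' = ev (zv ∘ Sum.inl) (zv ∘ Sum.inr) c - c.2.2 := by
    intro c zv
    simp only [Arow, ev, LinearMap.coe_mk, AddHom.coe_mk, dotProduct, Fintype.sum_sum_type, Sum.elim_inl,
      Sum.elim_inr, Function.comp_apply]
    ring
  have hErow : ∀ (e : (⊤ : SimpleGraph (Fin m)).edgeSet) (zv : ((⊤ : SimpleGraph (Fin m)).edgeSet ⊕ Fin r) → ℝ),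
      ∑ c', A (Sum.inr e) c' * zv c' = zv (Sum.inl e) := by
    intro e zv
    simp only [A, Sum.elim_inr, Fintype.sum_sum_type, Sum.elim_inl, Pi.zero_apply, zero_mul,
      Finset.sum_const_zero, add_zero, ite_mul, one_mul]
    rw [Finset.sum_ite_eq']
    simp
  have hBrow : ∀ (e : (⊤ : SimpleGraph (Fin m)).edgeSet) (x : (⊤ : SimpleGraph (Fin m)).edgeSet → Bool),
      ∑ e', B (Sum.inr e) e' * (if x e' then (1 : ℝ) else 0) = if x e then 1 else 0 := by
    intro e x
    simp only [B, Sum.elim_inr, ite_mul, one_mul, zero_mul]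
    rw [Finset.sum_ite_eq']
    simp
  have hBrow0 : ∀ (β : bf ⊕ bf) (x : (⊤ : SimpleGraph (Fin m)).edgeSet → Bool),
      ∑ e', B (Sum.inl β) e' * (if x e' then (1 : ℝ) else 0) = 0 := by
    intro β x
    simp [B]
  -- feasibility unpacked
  have hrows_iff : ∀ (x : (⊤ : SimpleGraph (Fin m)).edgeSet → Bool) (zv : ((⊤ : SimpleGraph (Fin m)).edgeSet ⊕ Fin r) → ℝ),
      (∀ i, ∑ c', A i c' * zv c' ≤ bvec i + ∑ e, B i e * (if x e then (1 : ℝ) else 0)) ↔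
        ((∀ β : bf, ev (zv ∘ Sum.inl) (zv ∘ Sum.inr) β.1 = 0) ∧
          ∀ e, zv (Sum.inl e) ≤ (if x e then (1 : ℝ) else 0)) := by
    intro x zv
    constructor
    · intro h
      refine ⟨fun β => ?_, fun e => ?_⟩
      · have h1 := h (Sum.inl (Sum.inl β))
        have h2 := h (Sum.inl (Sum.inr β))
        rw [hBrow0] at h1 h2
        simp only [A, bvec, Sum.elim_inl, Sum.elim_inr, add_zero] at h1 h2
        rw [hArow] at h1
        have h2' : ∑ c', (-Arow β.1) c' * zv c' = -(ev (zv ∘ Sum.inl) (zv ∘ Sum.inr) β.1 - β.1.2.2) := by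
          rw [← hArow, ← Finset.sum_neg_distrib]
          exact Finset.sum_congr rfl fun c' _ => by simp [neg_mul]
        rw [h2'] at h2
        linarith
      · have h1 := h (Sum.inr e)
        rw [hBrow, hErow] at h1
        simp only [bvec, Sum.elim_inr, zero_add] at h1
        exact h1
    · rintro ⟨hβ, hx⟩ (⟨β | β⟩ | e)
      · have h1 := hβ β
        rw [hBrow0]
        simp only [A, bvec, Sum.elim_inl, add_zero]
        rw [hArow]
        linarith
      · have h1 := hβ β
        rw [hBrow0]
        have h2' : ∑ c', A (Sum.inl (Sum.inr β)) c' * zv c' = -(ev (zv ∘ Sum.inl) (zv ∘ Sum.inr) β.1 - β.1.2.2) := by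
          simp only [A, Sum.elim_inl, Sum.elim_inr]
          rw [← hArow, ← Finset.sum_neg_distrib]
          exact Finset.sum_congr rfl fun c' _ => by simp [neg_mul]
        rw [h2']
        simp only [bvec, Sum.elim_inl, Sum.elim_inr, add_zero]
        linarith
      · rw [hBrow, hErow]
        simp only [bvec, Sum.elim_inr, zero_add]
        exact hx e
  constructor
  · -- completeness: `(1_Q, V · Q)` for a `k`-clique `Q ⊆ x`
    intro hx
    obtain ⟨Q, hQk, hQx⟩ := exists_cliqueVec_le_of_cliqueFn hx
    refine ⟨Sum.elim (fun e => if cliqueVec Q e then (1 : ℝ) else 0) (fun l => V l Q), ?_, ?_⟩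
    · rintro (e | l)
      · simp only [Sum.elim_inl]; split_ifs <;> norm_num
      · exact hV l Q
    · rw [hrows_iff]
      refine ⟨fun β => ?_, fun e => ?_⟩
      · obtain ⟨⟨u, hu⟩, hβu⟩ : β.1 ∈ T := hbT (Finset.mem_coe.2 β.2)
        rw [← hβu, hev]
        have h := hfact Q u hQk hu
        simp only [Function.comp_apply, Sum.elim_inl, Sum.elim_inr]
        have hsum : ∑ e, (if u e then (0 : ℝ) else 1) * (if cliqueVec Q e then (1 : ℝ) else 0) =
            ∑ e, if cliqueVec Q e = true ∧ u e = false then (1 : ℝ) else 0 := by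
          refine Finset.sum_congr rfl fun e _ => ?_
          cases u e <;> cases cliqueVec Q e <;> simp
        rw [hsum]
        linarith
      · simp only [Sum.elim_inl]
        by_cases hQe : cliqueVec Q e = true
        · rw [if_pos hQe, if_pos (hQx e hQe)]
        · rw [if_neg hQe]; split_ifs <;> norm_num
  · -- soundness
    rintro ⟨zv, hz, hrows⟩
    by_contra hx
    rw [Bool.not_eq_true] at hx
    rw [hrows_iff] at hrows
    obtain ⟨hβ, hxe⟩ := hrows
    have hall := forall_eq_zero_of_span (ev (zv ∘ Sum.inl) (zv ∘ Sum.inr)) hTspan (fun c hc => hβ ⟨c, hc⟩)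
    have hxeq := hall (φ x) ⟨⟨x, hx⟩, rfl⟩
    rw [hev] at hxeq
    -- `x' = 0` off `x`, so the first sum vanishes
    have hfirst : ∑ e, (if x e then (0 : ℝ) else 1) * (zv ∘ Sum.inl) e = 0 := by
      refine Finset.sum_eq_zero fun e _ => ?_
      cases hxe' : x e
      · have h1 := hxe e
        rw [hxe'] at h1
        simp only [Function.comp_apply, Bool.false_eq_true, ite_false, one_mul]
        simp only [Bool.false_eq_true, ite_false] at h1
        exact le_antisymm h1 (hz _)
      · simp
    have hsecond : 0 ≤ ∑ l, U x l * (zv ∘ Sum.inr) l :=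
      Finset.sum_nonneg fun l _ => mul_nonneg (hU x l) (hz _)
    rw [hfirst] at hxeq
    linarith

/-- **The LP slice of the crux ⟺ an ε-sensitive rank bound for the clique-distance matrices.** For a fixed
`δ`: (for every `c`, eventually, `D - εJ` of `CLIQUE(m, ⌈m^δ⌉₊)` has no non-negative factorisation with
`≤ m^c` terms for any `ε > 0`) ↔ (for every `c`, eventually, no LP data with `p + q ≤ m^c` compute
`CLIQUE(m, ⌈m^δ⌉₊)`). [folklore assembly; cf. Hrubeš 2020 (`Hrubes2020`), Thm. 20] -/
theorem cliqueDist_rankHard_iff_lpDataHard (δ : ℝ) :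
    (∀ c : ℕ, ∀ᶠ m : ℕ in Filter.atTop, ∀ ε : ℝ, 0 < ε → ∀ r : ℕ, r ≤ m ^ c →
      ∀ (U : ((⊤ : SimpleGraph (Fin m)).edgeSet → Bool) → Fin r → ℝ) (V : Fin r → Finset (Fin m) → ℝ),
        (∀ u l, 0 ≤ U u l) → (∀ l Q, 0 ≤ V l Q) →
        ¬ ∀ (Q : Finset (Fin m)) (u : (⊤ : SimpleGraph (Fin m)).edgeSet → Bool), Q.card = ⌈(m : ℝ) ^ δ⌉₊ →
            cliqueFn m ⌈(m : ℝ) ^ δ⌉₊ u = false →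
              (∑ e, if cliqueVec Q e = true ∧ u e = false then (1 : ℝ) else 0) - ε = ∑ l, U u l * V l Q) ↔
    (∀ c : ℕ, ∀ᶠ m : ℕ in Filter.atTop, ∀ (p q : ℕ), p + q ≤ m ^ c →
      ∀ (A : Fin p → Fin q → ℝ) (b : Fin p → ℝ) (B : Fin p → (⊤ : SimpleGraph (Fin m)).edgeSet → ℝ), (∀ i e, 0 ≤ B i e) →
        ¬ ∀ x : (⊤ : SimpleGraph (Fin m)).edgeSet → Bool, cliqueFn m ⌈(m : ℝ) ^ δ⌉₊ x = true ↔
          ∃ z : Fin q → ℝ, (∀ j, 0 ≤ z j) ∧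
            ∀ i, ∑ j, A i j * z j ≤ b i + ∑ e, B i e * (if x e then (1 : ℝ) else 0)) := by
  classical
  refine ⟨lpDataHard_of_cliqueDist_rankHard δ, fun h c => ?_⟩
  filter_upwards [h (c + 3), Filter.eventually_ge_atTop 9] with m hm hm9 ε hε r hr U V hU hV hfact
  obtain ⟨R, instR, hcardR, A, b, B, hB, hiff⟩ := exists_lpData_of_cliqueDist_factorisation hε U V hU hV hfact
  obtain ⟨A', b', B', hB', hre⟩ := lp_feasible_reindex A b B
  have hn : Fintype.card (⊤ : SimpleGraph (Fin m)).edgeSet ≤ m ^ 2 := card_edgeSet_top_le m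
  have h1 : 1 ≤ m := by omega
  have e1 : m ^ c ≤ m ^ (c + 2) := Nat.pow_le_pow_right h1 (by omega)
  have e2 : m ^ 2 ≤ m ^ (c + 2) := Nat.pow_le_pow_right h1 (by omega)
  have e3 : 1 ≤ m ^ (c + 2) := Nat.one_le_pow _ _ h1
  have e9 : 9 * m ^ (c + 2) ≤ m ^ (c + 3) := by
    calc 9 * m ^ (c + 2) = m ^ (c + 2) * 9 := Nat.mul_comm _ _
      _ ≤ m ^ (c + 2) * m := Nat.mul_le_mul_left _ hm9
      _ = m ^ (c + 3) := (pow_succ m (c + 2)).symm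
  have hC : Fintype.card ((⊤ : SimpleGraph (Fin m)).edgeSet ⊕ Fin r) = Fintype.card (⊤ : SimpleGraph (Fin m)).edgeSet + r := by simp [Fintype.card_sum]
  have hsize : Fintype.card R + Fintype.card ((⊤ : SimpleGraph (Fin m)).edgeSet ⊕ Fin r) ≤ m ^ (c + 3) := by
    rw [hC]
    omega
  refine hm _ _ hsize A' b' B' (fun i e => by rw [hB']; exact hB _ e) fun x => ?_
  rw [hiff x]
  obtain ⟨hb', hiff'⟩ := hre (fun ρ => b ρ + ∑ e, B ρ e * (if x e then (1 : ℝ) else 0))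
  rw [hiff']
  refine exists_congr fun z' => and_congr_right fun _ => forall_congr' fun i => ?_
  rw [hb' i]
  simp only [hB']

end Summit.PneNP.PneNP.Theorems
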